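import Literature.NumberTheory.EllipticCurves.ModularCurveGamma0IndexProofs
import Literature.NumberTheory.EllipticCurves.ModularCurveCuspsProofs
import Literature.NumberTheory.EllipticCurves.ModularCurveEllipticPointsProofs
import HarnessLib

/-!
# `dim S₂(Γ₀(N)) = g(X₀(N))` from the Riemann surface input alone (trunk EllArithM, item C17)

`Literature.NumberTheory.EllipticCurves.ModularCurveProofs` records the printed proof of
`Literature.ModularForms.finrank_cuspForm_two_eq_genusX0 N` (`dim_ℂ S₂(Γ₀(N)) = genusX0 N`,
Diamond–Shurman Thm. 3.5.1 with Thm. 3.1.1 and §3.7–3.9) as a DAG of five inputs and the proved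
assembly step `finrank_cuspForm_two_eq_genusX0_of`. Four of the five inputs are now theorems:

* `index_gamma0_eq_gamma0Index_holds` (`[SL₂(ℤ) : Γ₀(N)] = ∏ p^{e−1}(p + 1)`,
  `ModularCurveGamma0IndexProofs`),
* `numCusps_eq_nuInfty_holds` (`ε_∞(Γ₀(N)) = ∑_{d ∣ N} φ(gcd(d, N/d))`, `ModularCurveCuspsProofs`),
* `ellipticPointCount_two_gamma0_holds`, `ellipticPointCount_three_gamma0_holds`
  (`ε₂(Γ₀(N)) = #{n | n² + 1 ≡ 0}`, `ε₃(Γ₀(N)) = #{n | n² + n + 1 ≡ 0}`,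
  `ModularCurveEllipticPointsProofs`).

This file feeds them in, leaving the dimension formula and the exact genus formula for `X₀(N)`
conditional only on the one genuinely analytic input, the named fact
`twelve_mul_finrank_cuspForm_two (Gamma0 N)`:
`12 · dim S₂(Γ) + 3ε₂ + 4ε₃ + 6ε_∞ = 12 + [SL₂(ℤ) : {±I}Γ]` (Diamond–Shurman Thm. 3.1.1, the
Riemann–Hurwitz genus formula for `X(Γ) → X(1)`, combined with Thm. 3.5.1 for `k = 2`,
`dim S₂(Γ) = g` by Riemann–Roch), which requires the compact Riemann surface `X(Γ)` and is not
available at the Mathlib pin.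

## References

* F. Diamond, J. Shurman, *A first course in modular forms*, GTM 228, Springer (2005),
  Thm. 3.1.1, Thm. 3.5.1, §3.9 (Figure 3.3: the data `d, ε₂, ε₃, ε_∞` for `Γ₀(N)`).
* G. Shimura, *Introduction to the arithmetic theory of automorphic functions* (1971),
  Prop. 1.40, Prop. 1.43, Thm. 2.24.
-/

noncomputable section

open scoped MatrixGroups ModularForm

open CongruenceSubgroup

namespace Literature.NumberTheory.EllipticCurves.ModularForms

variable (N : ℕ) [NeZero N]

/-- **`12 · dim S₂(Γ₀(N)) + 3ν₂ + 4ν₃ + 6ν_∞ = 12 + μ`** with the closed forms `nu₂`, `nu₃`,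
`nuInfty`, `gamma0Index` of `ModularCurve.lean`, conditional only on the genus/dimension formula
for `X(Γ₀(N))` (Diamond–Shurman Thm. 3.1.1 with Thm. 3.5.1 and Figure 3.3).
[cite: DiamondShurman2005, §3.9 Figure 3.3] -/
theorem twelve_mul_finrank_cuspForm_two_gamma0_of_twelve_mul
    (h : twelve_mul_finrank_cuspForm_two (Gamma0 N)) :
    12 * Module.finrank ℂ (CuspForm (Gamma0 N) 2) + 3 * nu₂ N + 4 * nu₃ N + 6 * nuInfty N =
      12 + gamma0Index N :=
  twelve_mul_finrank_cuspForm_two_gamma0 N h (ellipticPointCount_two_gamma0_holds N)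
    (ellipticPointCount_three_gamma0_holds N) (numCusps_eq_nuInfty_holds N)
    (index_gamma0_eq_gamma0Index_holds N)

/-- **`dim S₂(Γ₀(N)) = g(X₀(N))`, conditional only on the Riemann surface input**: the fact
`finrank_cuspForm_two_eq_genusX0 N` (Diamond–Shurman Thm. 3.5.1) follows from
`twelve_mul_finrank_cuspForm_two (Gamma0 N)` (Thm. 3.1.1 + Thm. 3.5.1 for `X(Γ₀(N))`), the
index, cusp and elliptic-point counts of `Γ₀(N)` being theorems.
[cite: DiamondShurman2005, Thm. 3.5.1] -/
theorem finrank_cuspForm_two_eq_genusX0_of_twelve_mul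
    (h : twelve_mul_finrank_cuspForm_two (Gamma0 N)) : finrank_cuspForm_two_eq_genusX0 N :=
  finrank_cuspForm_two_eq_genusX0_of N h (ellipticPointCount_two_gamma0_holds N)
    (ellipticPointCount_three_gamma0_holds N) (numCusps_eq_nuInfty_holds N)
    (index_gamma0_eq_gamma0Index_holds N)

/-- **Exact genus formula for `X₀(N)`, conditional only on the Riemann surface input**: the fact
`twelve_mul_genusX0 N` of `ModularCurve.lean` (`12 g + 3ν₂ + 4ν₃ + 6ν_∞ = 12 + μ` for
`g = genusX0 N`; Shimura Prop. 1.40 with Prop. 1.43) follows from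
`twelve_mul_finrank_cuspForm_two (Gamma0 N)`. [cite: ShimuraIATAF1971, Prop. 1.40] -/
theorem twelve_mul_genusX0_of_twelve_mul (h : twelve_mul_finrank_cuspForm_two (Gamma0 N)) :
    twelve_mul_genusX0 N :=
  twelve_mul_genusX0_of N h (ellipticPointCount_two_gamma0_holds N)
    (ellipticPointCount_three_gamma0_holds N) (numCusps_eq_nuInfty_holds N)
    (index_gamma0_eq_gamma0Index_holds N)

end Literature.NumberTheory.EllipticCurves.ModularForms

end
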